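import Literature.AnabelianGeometry.EtaleTheta.FrobenioidThetaOfBiKummerData
import Literature.AlgebraicGeometry.Frobenioids.ModelFrobenioidBaseSection
import Literature.AlgebraicGeometry.Frobenioids.ModelFrobenioidPreSteps
import Literature.AlgebraicGeometry.Frobenioids.DivisorialDescriptionsIII

/-!
# [EtTh] §5: the section `s^trv_N : Aut_D(A_N^bs) → Aut_C(A_N)` CONSTRUCTED for the assembled data, and the divisor-invariance clauses (pp. 330–331 / PDF pp. 104–105)

Mochizuki, *The étale theta function …*, Publ. RIMS **45** (2009)
[cite: MochizukiEtTh2009, §5 p.330–331 (PDF pp.104–105)].  Seat abc-iut-L2-t4 (§5 owner), merge row W3-L2-01 «§5 GENUINE DATA»,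
sequel of `FrobenioidThetaOfBiKummerData.lean` (p417743).  ADDITIVE.

§5 p.330–331 (PDF pp.104–105): "the group homomorphism `s^trv_N : Aut_D(A_N^bs) → Aut_C(A_N)` arising from a base-Frobenius pair of
`A_N` [cf. Proposition 5.1; Theorem 3.7, (i); [FrdI], Proposition 5.6], which is completely determined … up to conjugation by an
element of `O^×(A_N)`".  In `ThetaFrobenioid.ofBiKummerData` (W3-L2-01 FILE 1) `s^trv_N` is the parameter `σ` with its section
property `hσ` as a hypothesis.  Here, over the MODEL Frobenioid ([FrdI] Thm. 5.2; the tempered Frobenioid of Def. 3.6 (ii)):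
* `ModelFrobenioid.zeroAutSection` — the base-section of [FrdI] Thm. 5.2's proof (kurims p.101: "the objects `(A_D, 0)` … together
  with the morphisms `(deg_Fr, Base, 0, 1)` … determine a base-Frobenius pair of `C`"; abc-iut-L1's `zeroPresection`) on
  AUTOMORPHISMS: `g ↦ (1, g, 0, 1) ∈ Aut_C((A_D, 0))`, a group homomorphism and a section of `Aut_C → Aut_D`;
* `ModelFrobenioid.conjAutSection` — its transport to any `Y ≅ (A_D, 0)`, again a section; and by [FrdI] Thm. 5.1 (iii) ("the
  isomorphism class of a Frobenius-trivial object is determined by that of its base", abc-iut-L1 `thm51iii_iso_of_baseIso`, PROVED)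
  every Frobenius-trivial object — e.g. the `N`-domain `A_N` of a root (Def. 4.1 (iv)(a)) — is such a `Y`:
  `ModelFrobenioid.frobTrivSection`, with `baseMap_frobTrivSection` (the section property is a THEOREM);
* for the assembled §5 data: with ANY section `σ` the hypotheses `hdivc` / `hdivp` of `ofBiKummerData` REDUCE to the bare
  divisor-invariance clauses of print — "the zero divisor `Div(s^⊓_N)` … descends … to `Φ(A_⊚)` [cf. Proposition 1.4, (i)]" (p.330 (PDF
  p.104)), i.e. `Φ(g)(Div s^⊓_N) = Div s^⊓_N` for all `g ∈ Aut_D(A_N^bs)`, and "`Div(s''_N)` … fixed by `H`" (Prop. 4.3 (i) proof, p.317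
  (PDF p.91)), i.e. `Φ(ρ_{A_N}(y))(Div s^⊔_N) = Div s^⊔_N` for `y ∈ Π^tp_Ÿ` — `hdivc_of_pull_invariant` / `hdivp_of_pull_invariant`
  (an automorphism has `Div = 0` for `Φ` divisorial).
HONEST FRAMING: constructions and kernel-checked reductions; the Frobenius half `F` of the base-Frobenius PAIR ([FrdI] Def. 2.7) is
abc-iut-L1's `zeroFrobeniusSection` and is not needed by §5's statements; nothing of [EtTh] is asserted unconditionally; no side taken
downstream.
-/

noncomputable section

/-! ## Sections of `Aut_C(X) → Aut_D(X^bs)` in a model Frobenioid -/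

namespace Literature.AlgebraicGeometry.Frobenioids

namespace ModelFrobenioid

open CategoryTheory Opposite

universe w v u

variable {D : Type u} [Category.{v} D] {Φ B : Dᵒᵖ ⥤ CommMonCat.{w}} {DivB : B ⟶ monoidGp Φ}

/-- The lift `(1, g, 0, 1) ∈ Aut_C((A_D, 0))` of an automorphism `g` of `A_D` ([FrdI] Thm. 5.2 proof, kurims p.101: the morphisms
"`(deg_Fr(φ), Base(φ), Div(φ), u_φ)` … such that `Div(φ) = 0`, `u_φ = 1`" over the objects with `α = 0`).
[cite: MochizukiFrdI2008, Thm. 5.2 p.101] -/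
def zeroAut (X : ModelFrobenioid Φ B DivB) (hX : X.cls = 1) (g : Aut X.base) : Aut X where
  hom := mkHom X X 1 g.hom 1 1 (by rw [hX]; simp only [one_pow, map_one, mul_one])
  inv := mkHom X X 1 g.inv 1 1 (by rw [hX]; simp only [one_pow, map_one, mul_one])
  hom_inv_id := by
    refine hom_ext ?_ ?_ ?_ ?_
    · show (1 : ℕ+) * 1 = 1
      rw [mul_one]
    · show g.hom ≫ g.inv = 𝟙 _
      exact g.hom_inv_id
    · show pull Φ g.hom 1 * (1 : Φ.obj (op X.base)) ^ ((1 : ℕ+) : ℕ) = 1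
      rw [map_one, one_pow, mul_one]
    · show pull B g.hom 1 * (1 : B.obj (op X.base)) ^ ((1 : ℕ+) : ℕ) = 1
      rw [map_one, one_pow, mul_one]
  inv_hom_id := by
    refine hom_ext ?_ ?_ ?_ ?_
    · show (1 : ℕ+) * 1 = 1
      rw [mul_one]
    · show g.inv ≫ g.hom = 𝟙 _
      exact g.inv_hom_id
    · show pull Φ g.inv 1 * (1 : Φ.obj (op X.base)) ^ ((1 : ℕ+) : ℕ) = 1
      rw [map_one, one_pow, mul_one]
    · show pull B g.inv 1 * (1 : B.obj (op X.base)) ^ ((1 : ℕ+) : ℕ) = 1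
      rw [map_one, one_pow, mul_one]

/-- **The zero section on automorphisms**: `g ↦ (1, g, 0, 1)`, `Aut_D(A_D) → Aut_C((A_D, 0))`, a group homomorphism (the
automorphism part of the base-section of [FrdI] Thm. 5.2's proof, kurims p.101).  [cite: MochizukiFrdI2008, Thm. 5.2 p.101] -/
def zeroAutSection (X : ModelFrobenioid Φ B DivB) (hX : X.cls = 1) : Aut X.base →* Aut X where
  toFun := zeroAut X hX
  map_one' := Aut.ext (hom_ext rfl rfl rfl rfl)
  map_mul' g g' := by
    apply Aut.ext
    refine hom_ext ?_ rfl ?_ ?_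
    · show (1 : ℕ+) = 1 * 1
      rw [mul_one]
    · show (1 : Φ.obj (op X.base)) = pull Φ g'.hom 1 * (1 : Φ.obj (op X.base)) ^ ((1 : ℕ+) : ℕ)
      rw [map_one, one_pow, mul_one]
    · show (1 : B.obj (op X.base)) = pull B g'.hom 1 * (1 : B.obj (op X.base)) ^ ((1 : ℕ+) : ℕ)
      rw [map_one, one_pow, mul_one]

/-- The zero section is a section: `Base((1, g, 0, 1)) = g`. [cite: MochizukiFrdI2008, Thm. 5.2 p.101] -/
@[simp] theorem baseMap_zeroAutSection (X : ModelFrobenioid Φ B DivB) (hX : X.cls = 1) (g : Aut X.base) :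
    baseMap (zeroAutSection X hX g).hom = g.hom := rfl

/-- `Div((1, g, 0, 1)) = 0`. [cite: MochizukiFrdI2008, Thm. 5.2 p.101] -/
@[simp] theorem div_zeroAutSection (X : ModelFrobenioid Φ B DivB) (hX : X.cls = 1) (g : Aut X.base) :
    div (zeroAutSection X hX g).hom = 1 := rfl

/-- `u_{(1, g, 0, 1)} = 1`. [cite: MochizukiFrdI2008, Thm. 5.2 p.101] -/
@[simp] theorem unit_zeroAutSection (X : ModelFrobenioid Φ B DivB) (hX : X.cls = 1) (g : Aut X.base) :
    unit (zeroAutSection X hX g).hom = 1 := rfl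

/-- Transport of a homomorphism `σ₀ : Aut_D(X^bs) → Aut_C(X)` along an isomorphism `e : Y ≅ X` of `C`:
`g ↦ e⁻¹ ∘ σ₀(Base(e) g Base(e)⁻¹) ∘ e` (base-Frobenius pairs are determined up to such conjugations, [FrdI] Prop. 5.6).
[cite: MochizukiFrdI2008, Prop. 5.6 p.105] -/
def conjAutSection {X Y : ModelFrobenioid Φ B DivB} (e : Y ≅ X) (σ₀ : Aut X.base →* Aut X) : Aut Y.base →* Aut Y :=
  e.symm.conjAut.toMonoidHom.comp (σ₀.comp ((baseFunctor Φ B DivB).mapIso e).conjAut.toMonoidHom)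

/-- A transported section is a section: `Base(e⁻¹ ∘ σ₀(Base(e) g Base(e)⁻¹) ∘ e) = g`.
[cite: MochizukiFrdI2008, Prop. 5.6 p.105] -/
theorem baseMap_conjAutSection {X Y : ModelFrobenioid Φ B DivB} (e : Y ≅ X) (σ₀ : Aut X.base →* Aut X)
    (hσ₀ : ∀ g : Aut X.base, baseMap (σ₀ g).hom = g.hom) (g : Aut Y.base) :
    baseMap (conjAutSection e σ₀ g).hom = g.hom := by
  change baseMap (e.symm.conjAut (σ₀ (((baseFunctor Φ B DivB).mapIso e).conjAut g))).hom = g.hom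
  rw [Iso.conjAut_hom, Iso.conj_apply, Iso.symm_inv, Iso.symm_hom, baseMap_comp, baseMap_comp, hσ₀, Iso.conjAut_hom,
    Iso.conj_apply, Functor.mapIso_inv, Functor.mapIso_hom]
  change baseMap e.hom ≫ (baseMap e.inv ≫ g.hom ≫ baseMap e.hom) ≫ baseMap e.inv = g.hom
  have h1 : baseMap e.hom ≫ baseMap e.inv = 𝟙 _ := by rw [← baseMap_comp, e.hom_inv_id]; rfl
  simp only [Category.assoc]
  rw [h1, Category.comp_id, ← Category.assoc, h1, Category.id_comp]

/-- A Frobenius-trivial object of the model Frobenioid is isomorphic to `(A_D, 0)` over its own base — [FrdI] Thm. 5.1 (iii)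
("the isomorphism class of a Frobenius-trivial object … is completely determined by the isomorphism class of its projection to `D`";
abc-iut-L1 `PreFrobenioid.thm51iii_iso_of_baseIso`, PROVED) with [FrdI] Thm. 5.2 (ii) (`C` is a Frobenioid of isotropic type) and
the Frobenius-triviality of `(A_D, 0)` (`isFrobeniusTrivial_zeroObj`).  [cite: MochizukiFrdI2008, Thm. 5.1 (iii) p.97] -/
theorem nonempty_iso_zeroObj (h : Hypotheses Φ B) (X : ModelFrobenioid Φ B DivB)
    (hX : PreFrobenioid.IsFrobeniusTrivial (toElem Φ B DivB) X) : Nonempty (X ≅ zeroObj Φ B DivB X.base) :=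
  PreFrobenioid.thm51iii_iso_of_baseIso (toElem Φ B DivB)
    (isFrobenioid (DivB := DivB) h.isMonoidOn h.isDivisorial h.isMonoidOn_rat h.isGroupLike_rat h.isGraphConnected
      h.isTotallyEpimorphic)
    (isOfIsotropicType h.isGroupLike_rat) X _ hX (isFrobeniusTrivial_zeroObj h.isGroupLike_rat _) ⟨Iso.refl _⟩

/-- **A section `Aut_D(X^bs) → Aut_C(X)` of every Frobenius-trivial object `X`** of the model Frobenioid ("the group homomorphism …
arising from a base-Frobenius pair of `A_N`", [EtTh] §5 p.330 (PDF p.104); [FrdI] Prop. 5.6): the zero section of `(X^bs, 0)`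
transported along an isomorphism `X ≅ (X^bs, 0)` ([FrdI] Thm. 5.1 (iii)).  [cite: MochizukiFrdI2008, Prop. 5.6 p.105] -/
def frobTrivSection (h : Hypotheses Φ B) (X : ModelFrobenioid Φ B DivB)
    (hX : PreFrobenioid.IsFrobeniusTrivial (toElem Φ B DivB) X) : Aut X.base →* Aut X :=
  conjAutSection (Classical.choice (nonempty_iso_zeroObj h X hX)) (zeroAutSection (zeroObj Φ B DivB X.base) rfl)

/-- `frobTrivSection` is a section: `Base(σ(g)) = g`. [cite: MochizukiFrdI2008, Prop. 5.6 p.105] -/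
theorem baseMap_frobTrivSection (h : Hypotheses Φ B) (X : ModelFrobenioid Φ B DivB)
    (hX : PreFrobenioid.IsFrobeniusTrivial (toElem Φ B DivB) X) (g : Aut X.base) :
    baseMap (frobTrivSection h X hX g).hom = g.hom :=
  baseMap_conjAutSection _ _ (fun g' => baseMap_zeroAutSection _ rfl g') g

end ModelFrobenioid

end Literature.AlgebraicGeometry.Frobenioids

/-! ## The §5 assembled data: `s^trv_N` constructed; the divisor-invariance clauses -/

namespace Literature.AnabelianGeometry.EtaleTheta

open CategoryTheory Opposite Literature.AlgebraicGeometry.Frobenioids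

universe u₀ v₀ u v w

namespace ThetaFrobenioid

variable {K : Type u₀} [Field K] {X : SemiGraphs.TemperedArithmeticGroup.{u₀} K} {D₀ : Type u₀} [Category.{v₀} D₀]
  {V : FrdIMonoidStub.{w}} {T₀ : RealifiedDivisorMonoids (D₀ := D₀) V} {D : Type u} [Category.{v} D]
  {VD : FrdICatStub.{u, v, w} D} {S : BiKummerSetting X T₀ D VD}
  {pullFrac : ∀ {A A' : S.C} (_ : A' ⟶ A), S.biratUnits A → S.biratUnits A'}
  {lv N : ℕ+} {T : ThetaEnvData.{max v w} N} {θ : S.biratUnits S.Aodot} {Bl : S.C}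
  {Pl : S.FractionPair θ Bl} {Rl : S.NthRoot θ Pl lv pullFrac}
  (h : ModelFrobenioid.Hypotheses S.tf.divisorMonoid S.tf.ratFnFunctor)
  (hΦd : Objectwise (fun M _ => IsDivisorial M) S.tf.divisorMonoid) (R : S.NthRoot Rl.root Rl.pair N pullFrac)
  (ιX : T.PiX ≃ₜ* X.Pi)

/-- **`s^trv_N` for the assembled §5 data** (p.330–331 (PDF pp.104–105): "the group homomorphism `s^trv_N : Aut_D(A_N^bs) → Aut_C(A_N)`
arising from a base-Frobenius pair of `A_N`"): the section of the Frobenius-trivial `N`-domain `A_N` of the root (Def. 4.1 (iv)(a),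
carried by abc-iut-L2-t3's `NthRoot`: `R.αData.isFrobeniusTrivial`).  [cite: MochizukiEtTh2009, §5 p.330–331 (PDF pp.104–105)] -/
def strvOfBiKummerData : Aut R.AN.base →* Aut R.AN :=
  ModelFrobenioid.frobTrivSection h R.AN R.αData.isFrobeniusTrivial

/-- The constructed `s^trv_N` is a section — the hypothesis `hσ` of `strvSection_ofBiKummerData` / `facts_ofBiKummerData'` is a
THEOREM for `σ := strvOfBiKummerData h R`.  [cite: MochizukiEtTh2009, §5 p.331 (PDF p.105)] -/
theorem baseMap_strvOfBiKummerData (g : Aut R.AN.base) : ModelFrobenioid.baseMap (strvOfBiKummerData h R g).hom = g.hom :=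
  ModelFrobenioid.baseMap_frobTrivSection h R.AN R.αData.isFrobeniusTrivial g

include hΦd in
/-- **`hdivc` from divisor invariance** (p.330 (PDF p.104): "the zero divisor `Div(s^⊓_N) ∈ Φ(A_N)` of `s^⊓_N` descends … to `Φ(A_⊚)`"
— so it is fixed by every `g ∈ Aut_D(A_N^bs)`): for ANY section `σ` of `A_N`, `Div(σ(g') ∘ s^⊓_N) = Φ(g')(Div s^⊓_N)` (an automorphism
has `Div = 0`, `Φ` divisorial), so the hypothesis `hdivc` of `ofBiKummerData` holds as soon as `Φ(g)(Div s^⊓_N) = Div s^⊓_N` for all `g`.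
[cite: MochizukiEtTh2009, §5 p.330 (PDF p.104)] -/
theorem hdivc_of_pull_invariant (σ : Aut R.AN.base →* Aut R.AN)
    (hσ : ∀ g : Aut R.AN.base, ModelFrobenioid.baseMap (σ g).hom = g.hom)
    (hinv : ∀ g : Aut R.AN.base, pull S.tf.divisorMonoid g.hom (ModelFrobenioid.div R.pair.num) = ModelFrobenioid.div R.pair.num)
    (g : Aut R.BN.base) :
    ModelFrobenioid.div ((σ ((BiKummerSetting.NthRoot.baseIso S R).conjAut.symm g)).hom ≫ R.pair.num) =
      ModelFrobenioid.div R.pair.num := by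
  rw [ModelFrobenioid.div_comp_of_isIso' hΦd, hσ]
  exact hinv _

include hΦd in
/-- **`hdivp` from divisor invariance** (Prop. 4.3 (i) proof, p.317 (PDF p.91): "it suffices to prove that `Div(s'_N)`, `Div(s''_N) ∈
Φ(A_N)` are fixed by `H_{A_N}`" — "`N · Div(s''_N)` … arise[s] as the pull-back … of `Div(s'')` … `H` acts trivially on `A_⊙^bs`"):
for ANY section `σ`, the hypothesis `hdivp` of `ofBiKummerData` holds as soon as `Φ(ρ_{A_N}(y))(Div s^⊔_N) = Div s^⊔_N` for all
`y ∈ Π^tp_Ÿ`.  [cite: MochizukiEtTh2009, Prop 4.3 (i) p.317 (PDF p.91); §5 p.331 (PDF p.105)] -/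
theorem hdivp_of_pull_invariant (σ : Aut R.AN.base →* Aut R.AN)
    (hσ : ∀ g : Aut R.AN.base, ModelFrobenioid.baseMap (σ g).hom = g.hom)
    (hinv : ∀ y : T.PiX, y ∈ T.PiYdd →
      pull S.tf.divisorMonoid (S.galoisSurj R.AN.base R.αData.isGalois (ιX y)).hom (ModelFrobenioid.div R.pair.den) =
        ModelFrobenioid.div R.pair.den)
    (y : T.PiYdd) :
    ModelFrobenioid.div ((σ (S.galoisSurj R.AN.base R.αData.isGalois (ιX y.1))).hom ≫ R.pair.den) =
      ModelFrobenioid.div R.pair.den := by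
  rw [ModelFrobenioid.div_comp_of_isIso' hΦd, hσ]
  exact hinv y.1 y.2

end ThetaFrobenioid

end Literature.AnabelianGeometry.EtaleTheta

end
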